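import Mathlib
import Literature.NumberTheory.LFunctions.Zhang2022.AppendixBLemma151Mu3Value
import Literature.NumberTheory.LFunctions.Zhang2022.AppendixBPerronGeneric

/-!
# Zhang (2022) Appendix B, proof of Lemma 15.1, `μ = 3`: `StepB_mu3R` from a `(P_μ, β)`-GENERIC
# line-to-circle bound (interface edge for H-02)

Topic `Literature/NumberTheory/LFunctions/Zhang2022` (Landau–Siegel audit tree; verdict-neutral).
Y. Zhang, *Discrete mean estimates and the Landau–Siegel zero*, arXiv:2211.02515v1 (2022)
[Zhang2022LandauSiegel] — **an unrefereed manuscript under adjudication; nothing here asserts a claim of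
the manuscript.** ZHANG-L discharge lane (WP15, App. B leg B3 under leaf `Typed.Section15C.Eq15_22` /
Lemma 15.1 χR), DAG node `Z22:§B.u011` (text) [Z22 p.107, tex L5310].

`stepB_mu3R_of_generic` — **`Typed.AppendixB.StepB_mu3R c′` follows from ANY `(P_μ, β)`-generic
line-to-circle bound** of the shape
`∃ C D₀, ∀ D ≥ D₀, ∀ j ∈ {1,2,3}, ∀ P_μ l₁ β, 1 < P_μ → P_μ ≤ P → 1 ≤ l₁ → l₁ < T → β ≠ 0 → β ≠ β_j →
 Re β = 0 → ‖β‖ ≤ 3α → ‖(1/2π)∫_{(1)} F − (2πi)⁻¹∮_{|s|=5α} F‖ ≤ C·α₁`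
(`F = zetaRatio c′ D j · kerB P_μ β l₁`; the conclusion of the H-02 programme `vline_zetaRatio_kerB_sub_circle_le`):
the instance `(P₃, β₆)` meets every side condition for `D` large (`1 < P₃ ≤ P`, `Re β₆ = 0`, `β₆ ≠ 0`,
`β₆ ≠ β_j`, `‖β₆‖ = 3α/2 ≤ 3α`, `Skeleton.beta6_size`), and the `μ = 3` Perron identity
(`Skeleton.vkSum_vk3_eq_vline`), the two-circle split, the residue at `0` and the value of the
`β₆`-residue are THEOREMS (`AppendixBPerronGeneric`, `AppendixBLemma151Mu3Circles/Value`), assembled by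
`Skeleton.stepB_mu3R_of_perron_shift`.

WHAT THIS IS NOT: the generic bound itself, Lemma 15.1, or any claim about Theorems 1–2 / Landau–Siegel zeros.

## References

* Y. Zhang, arXiv:2211.02515v1 (2022), App. B p. 107. [cite: Zhang2022LandauSiegel, App. B p.107]
-/

noncomputable section

open Complex Real Metric Set Filter Topology

namespace Literature.NumberTheory.LFunctions.Zhang2022.Skeleton

open Typed.AppendixB (zetaRatio kerB vline vkSum)

/-- `L₀ ≤ log D` once `D ≥ ⌈exp L₀⌉₊`. [folklore] -/
private theorem le_ell_of_ceil_exp_le₆ {L₀ : ℝ} {D : ℕ} (hD : ⌈Real.exp L₀⌉₊ ≤ D) : L₀ ≤ ell D := by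
  have h : Real.exp L₀ ≤ D := le_trans (Nat.le_ceil _) (by exact_mod_cast hD)
  exact (Real.le_log_iff_exp_le (lt_of_lt_of_le (Real.exp_pos _) h)).mpr h

/-- **`StepB_mu3R` from a `(P_μ, β)`-generic line-to-circle bound at rate `α₁`** ("In case `μ = 3`
the proof can be obtained with `β₆` and `P₃` in place of `β₇` and `P₂`", App. B p. 107): the `μ = 3`
instance `(P₃, β₆)` satisfies every side condition of the generic bound for `D` large (`1 < P₃ ≤ P`,
`Re β₆ = 0`, `β₆ ≠ 0`, `β₆ ≠ β_j`, `‖β₆‖ = 3α/2 ≤ 3α`), and everything else of the `μ = 3` chain is a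
theorem (`stepB_mu3R_of_perron_shift`, `vkSum_vk3_eq_vline`). [cite: Zhang2022LandauSiegel, App. B p.107] -/
theorem stepB_mu3R_of_generic (c' : ℝ)
    (hgen : ∃ C : ℝ, ∃ D₀ : ℕ, ∀ D : ℕ, D₀ ≤ D → ∀ j ∈ ({1, 2, 3} : Finset ℕ),
      ∀ (Pμ : ℝ) (l₁ : ℕ) (β : ℂ), 1 < Pμ → Pμ ≤ bigP D → 1 ≤ l₁ → (l₁ : ℝ) < bigT D → β ≠ 0 →
        β ≠ betaJ c' D j → β.re = 0 → ‖β‖ ≤ 3 * alpha D →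
        ‖vline 1 (fun s => zetaRatio c' D j s * kerB Pμ β l₁ s) -
            (2 * π * I)⁻¹ * (∮ s in C((0 : ℂ), 5 * alpha D), zetaRatio c' D j s * kerB Pμ β l₁ s)‖ ≤
          C * alpha1 D) :
    Typed.AppendixB.StepB_mu3R c' := by
  refine stepB_mu3R_of_perron_shift c' (vkSum_vk3_eq_vline c') ?_
  obtain ⟨C, D₀, h⟩ := hgen
  refine ⟨C, max D₀ (max 8 ⌈Real.exp (max 2 (60 * |c'| * π))⌉₊), fun D _ χ hD hq hp j hj l₁ hl₁ _ hT => ?_⟩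
  have hD₀ : D₀ ≤ D := le_trans (le_max_left _ _) hD
  have hD8 : 8 ≤ D := le_trans (le_max_left _ _) (le_trans (le_max_right _ _) hD)
  have hℓ : max 2 (60 * |c'| * π) ≤ ell D :=
    le_ell_of_ceil_exp_le₆ (le_trans (le_max_right _ _) (le_trans (le_max_right _ _) hD))
  have hℓ2 : 2 ≤ ell D := le_trans (le_max_left _ _) hℓ
  have hℓ0 : 0 < ell D := by linarith
  have hα : alpha D = π / ell D ^ 9 := by rw [alpha, bigP, Real.log_exp]
  have hα0 : 0 < alpha D := by rw [hα]; positivity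
  have hc : 60 * |c'| * (alpha D * ell D) ≤ 1 := by
    have hcℓ : 60 * |c'| * π ≤ ell D := le_trans (le_max_right _ _) hℓ
    have hαℓ : alpha D * ell D ≤ π / ell D := by
      have h1 : alpha D * ell D = π / ell D ^ 8 := by
        rw [hα, eq_div_iff (pow_ne_zero _ hℓ0.ne')]; field_simp
      rw [h1]
      exact div_le_div_of_nonneg_left Real.pi_pos.le hℓ0
        (le_self_pow₀ (by linarith) (by norm_num))
    calc 60 * |c'| * (alpha D * ell D) ≤ 60 * |c'| * (π / ell D) := by gcongr
      _ = 60 * |c'| * π / ell D := by ring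
      _ ≤ 1 := by rw [div_le_one hℓ0]; exact hcℓ
  obtain ⟨hb6, hn6⟩ := beta6_size c' hℓ2 hc hj
  have hβ0 : beta6 D ≠ 0 := by intro h0; rw [h0, norm_zero] at hn6; linarith
  have hβb : beta6 D ≠ betaJ c' D j := by
    intro h0; rw [h0, sub_self, norm_zero] at hb6; linarith
  have hβre : (beta6 D).re = 0 := by simp [beta6]
  have hβ3 : ‖beta6 D‖ ≤ 3 * alpha D := by rw [hn6]; linarith
  have hD2 : 2 ≤ D := le_trans (by norm_num) hD8
  exact h D hD₀ j hj (P3 D) l₁ (beta6 D) (one_lt_P3 hD2) (P3_le_bigP D) hl₁ hT hβ0 hβb hβre hβ3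

end Literature.NumberTheory.LFunctions.Zhang2022.Skeleton
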